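import Mathlib
import Literature.LinearAlgebra.Matrix.ResolventPerturbation
import HarnessLib

/-!
# Block Gershgorin theorems (Feingold–Varga): partitioned nonsingularity, inclusion and counting

Topic `Literature/LinearAlgebra/Matrix`; support file (everything PROVED; no definitions; no named
facts). Sub-namespace `BlockGershgorin`. Companion of `…Gershgorin` (pointwise discs and the
homotopy engine `Gershgorin.countP_roots_charpoly_eq_of_isPreconnected`), `…BauerFike`
(approximate inverses) and `…Resolvent` (Kato's certified resolvent condition). Those count
eigenvalues relative to a DIAGONAL or an arbitrary reference matrix; this file supplies the
intermediate, PARTITIONED case of Feingold–Varga (1962) and Varga's book (2004, Ch. 6): the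
reference matrix is the block-diagonal part `D = diag(A₁₁, …, A_ℓℓ)` of `A` with respect to a
partition of the index set, every hypothesis is PER DIAGONAL BLOCK, and the eigenvalue count of the
reference is the sum of the counts of the diagonal blocks. This is the certificate for CLUSTERED or
defective spectra, where pointwise Gershgorin discs cannot be separated but small blocks can.

MODEL. `M : Matrix m m K`, a partition given by a labelling `b : m → ι` of the indices by blocks
(Mathlib's `Matrix.toSquareBlock` / `Matrix.BlockTriangular` convention): the diagonal block `i` is
`M.toSquareBlock b i : Matrix {a // b a = i} {a // b a = i} K`, the OFF-DIAGONAL BLOCK ROW `i` is the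
rectangular `M.toBlock (fun a => b a = i) (fun a => b a ≠ i)` (all columns outside block `i`), and
the `(i, j)` block is `M.toBlock (fun a => b a = i) (fun a => b a = j)`. Norm: the `ℓ∞` operator
norm (`open scoped Matrix.Norms.Operator`) on every block — this is Feingold–Varga's setting with
the norm tuple `φ = (ℓ∞, …, ℓ∞)`, for which Varga's compound norm (6.27) on `ℂⁿ` is again the `ℓ∞`
norm, so that `‖·‖_φ` of an `n × n` matrix is its `ℓ∞` operator norm. Feingold–Varga's radius
`rᵢ = Σ_{k ≠ i} ‖A_{ik}‖` ((2.4), Varga (6.8)) majorises the norm of the off-diagonal block row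
(`linfty_norm_offDiag_le`, Varga (6.30)), and the sharper "Robert" quantity
`‖(z − Aᵢᵢ)⁻¹ [A_{ik}]_{k ≠ i}‖` (Varga (6.35)) is the one the main statements use.

* NONSINGULARITY OF BLOCK DIAGONALLY DOMINANT MATRICES (Feingold–Varga Thm 1; Varga Def 6.1 (6.9),
  Thm 6.2): `linfty_isUnit_det_of_blockDominant` (literal: `‖Aᵢᵢ⁻¹‖ rᵢ < 1` for all `i`),
  `linfty_isUnit_det_of_blocks` (Robert form `‖Aᵢᵢ⁻¹ [A_{ik}]_{k≠i}‖ < 1`, Varga (6.35) at `z = 0`),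
  `linfty_isUnit_det_of_blocks_certified` (per-block approximate inverses `Yᵢ`,
  `‖1 − Yᵢ Aᵢᵢ‖ + ‖Yᵢ [A_{ik}]_{k≠i}‖ < 1` — the verifier's primitive, Golub–Van Loan Lemma 2.3.3).
* BLOCK GERSHGORIN INCLUSION (Feingold–Varga Thm 2 (2.10); Varga Thm 6.3 (6.12)–(6.13), Thm 6.12
  (6.34)–(6.37)): every eigenvalue `μ` satisfies `(‖(μ − Aᵢᵢ)⁻¹‖)⁻¹ ≤ rᵢ` for some block `i`
  (`linfty_exists_inv_norm_resolvent_le_of_isRoot_charpoly`, with Lean's `A⁻¹ = 0` for singular `A`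
  playing the role of Feingold–Varga's convention `(‖Aᵢᵢ⁻¹‖)⁻¹ := 0`); Robert form
  `linfty_exists_one_le_of_isRoot_charpoly`; exclusion of a point `z` by per-block exact or
  certified resolvent conditions (`linfty_not_isRoot_charpoly_of_blocks`, `…_certified`).
* BLOCK GERSHGORIN COUNTING (Feingold–Varga Thm 4: an isolated union of `m` block Gershgorin sets
  contains exactly `Σ nᵢ` eigenvalues; proof "depending on a continuity argument"): literal form
  over `ℂ`, `linfty_countP_roots_charpoly_blockGershgorin_eq_sum_card`, with the Gershgorin sets of
  Def 3 (3.1) `Gᵢ = {z | (‖(z − Aᵢᵢ)⁻¹‖)⁻¹ ≤ rᵢ}` for any radii `rᵢ ≥ Σ_{k≠i} ‖A_{ik}‖` and every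
  block label used; the sets are handled through their closed, certificate-dual form
  `{z | ∀ Y, 1 ≤ ‖1 − Y (z − Aᵢᵢ)‖ + ‖Y‖ rᵢ}` (`linfty_forall_one_le_iff_inv_norm_inv_le`, the
  pointwise equivalence for a nonempty block). Level-set form (Kato IV Thm 3.18 with the
  block-diagonal reference): if the per-block certified condition holds on a level curve `{φ = x₀}`
  then `#{eigenvalues of A with φ ≤ x₀} = Σᵢ #{eigenvalues of Aᵢᵢ with φ ≤ x₀}`, with algebraic
  multiplicity (`linfty_countP_roots_charpoly_eq_sum_of_blocks_certified`, exact-resolvent form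
  `…_of_blocks`, discs `linfty_countP_roots_charpoly_norm_sub_le_eq_sum_of_blocks_certified`).
* TOOL: the rectangular verified-inverse bound `‖V⁻¹ R‖ ≤ ‖Y R‖ / (1 − ‖1 − Y V‖)`
  (`linfty_norm_inv_mul_le_of_approxInverse`, Golub–Van Loan Lemma 2.3.3 for a rectangular right
  factor), converting per-block certificates into per-block Robert quantities, and Varga (6.30)
  `‖[A_{ik}]_{k≠i}‖_∞ ≤ Σ_{k≠i} ‖A_{ik}‖_∞` (`linfty_norm_offDiag_le`).

Mechanism (all proofs): assemble the block-diagonal exact inverse `Y = diag((z − Aᵢᵢ)⁻¹)`; then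
`Y (z − D) = 1` and `Y (A − D)` has zero diagonal blocks and off-diagonal block rows
`(z − Aᵢᵢ)⁻¹ [A_{ik}]_{k≠i}`, so its `ℓ∞` operator norm is the maximum of the per-block Robert
quantities (Varga's proof of Thm 6.13); this is exactly the certified resolvent condition of
`…Resolvent` for the pair `(D, A − D)`, whose theorems then apply, and `χ_D = ∏ᵢ χ_{Aᵢᵢ}`
(`Matrix.BlockTriangular.charpoly`).

Dictionary for the `cap.spectral` verifier (informal): `b` ↦ the cluster labelling of a computed
(block-)triangularisation, `Aᵢᵢ` ↦ small dense blocks whose eigenvalue counts in the region are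
certified separately (e.g. by `…Resolvent` on each block), `Yᵢ` ↦ float inverses of `z − Aᵢᵢ`
rounded to rationals, `[A_{ik}]_{k≠i}` ↦ the coupling; every hypothesis is a finite conjunction of
rational inequalities per block and per grid point.

NOT TYPED here: general norm tuples `φ` (only `ℓ∞` on every block); the irreducible boundary
refinements (Feingold–Varga Thm 3, Varga Thms 6.5–6.6); block Brauer–Cassini ovals and cycle sets
(Feingold–Varga Thm 6, Varga (6.16)–(6.23), Thms 6.7–6.11); Varga's comparison
`𝓗 ⊆ 𝓡 ⊆ Γ` of the three partitioned sets as SETS (Thm 6.13 (6.38)) — only its pointwise content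
(Robert condition fails ⇒ Gershgorin condition fails, `linfty_exists_inv_norm_resolvent_le_of_isRoot_charpoly`)
is formalised; minimal Gershgorin sets under partitioning (Varga §6.3–6.4).
-/

open Matrix Polynomial

namespace Literature.LinearAlgebra.Matrix.BlockGershgorin

/-! ### Algebra of a partition: blocks, the block-diagonal part, the assembled inverse -/

section Algebra

variable {R : Type*} {m : Type*} {ι : Type*}

/-- A square matrix is determined by its diagonal blocks and its off-diagonal block rows.
[folklore] -/
private theorem ext_of_toBlock (b : m → ι) {X X' : Matrix m m R}
    (hd : ∀ i, X.toBlock (fun a => b a = i) (fun a => b a = i) =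
      X'.toBlock (fun a => b a = i) (fun a => b a = i))
    (ho : ∀ i, X.toBlock (fun a => b a = i) (fun a => b a ≠ i) =
      X'.toBlock (fun a => b a = i) (fun a => b a ≠ i)) : X = X' := by
  ext a c
  by_cases h : b c = b a
  · have h1 := congr_fun (congr_fun (hd (b a)) ⟨a, rfl⟩) ⟨c, h⟩
    simpa only [toBlock_apply] using h1
  · have h1 := congr_fun (congr_fun (ho (b a)) ⟨a, rfl⟩) ⟨c, h⟩
    simpa only [toBlock_apply] using h1

/-- The row predicate of block `i` and the column predicate "outside block `i`" are disjoint.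
[folklore] -/
private theorem disjoint_eq_ne (b : m → ι) (i : ι) :
    Disjoint (fun a => b a = i) (fun a => b a ≠ i) := by
  rw [disjoint_iff_inf_le]
  exact fun a h => h.2 h.1

variable [CommRing R]

/-- Block rows of a product with a BLOCK-DIAGONAL left factor: `(Y N)_[i, q] = Yᵢᵢ N_[i, q]`.
[folklore] -/
private theorem toBlock_mul_of_offDiag_eq_zero [Fintype m] [DecidableEq ι] (b : m → ι)
    {Y : Matrix m m R}
    (hY : ∀ i, Y.toBlock (fun a => b a = i) (fun a => b a ≠ i) = 0) {k : Type*}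
    (N : Matrix m k R) (i : ι) (q : k → Prop) :
    (Y * N).toBlock (fun a => b a = i) q =
      Y.toBlock (fun a => b a = i) (fun a => b a = i) * N.toBlock (fun a => b a = i) q := by
  rw [toBlock_mul_eq_add (fun a => b a = i) (fun a => b a = i) q Y N]
  have h0 : Y.toBlock (fun a => b a = i) (fun a => ¬ b a = i) = 0 := hY i
  rw [h0, Matrix.zero_mul, add_zero]

/-- **The assembled block-diagonal inverse.** If `U` has zero off-diagonal block rows and every
diagonal block `Uᵢᵢ` is invertible, then `Y := diag(Uᵢᵢ⁻¹)` is a left inverse of `U` with diagonal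
blocks `Uᵢᵢ⁻¹` and zero off-diagonal block rows. [folklore] -/
private theorem exists_blockDiag_leftInverse [Fintype m] [DecidableEq m] [DecidableEq ι]
    (b : m → ι) {U : Matrix m m R}
    (hUoff : ∀ i, U.toBlock (fun a => b a = i) (fun a => b a ≠ i) = 0)
    (hU : ∀ i, IsUnit (U.toSquareBlock b i).det) :
    ∃ Y : Matrix m m R, Y * U = 1 ∧
      (∀ i, Y.toBlock (fun a => b a = i) (fun a => b a = i) = (U.toSquareBlock b i)⁻¹) ∧
      ∀ i, Y.toBlock (fun a => b a = i) (fun a => b a ≠ i) = 0 := by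
  obtain ⟨Y, hY⟩ : ∃ Y : Matrix m m R, Y = Matrix.of fun a c =>
      if h : b c = b a then (U.toSquareBlock b (b a))⁻¹ ⟨a, rfl⟩ ⟨c, h⟩ else 0 := ⟨_, rfl⟩
  have hYd : ∀ i, Y.toBlock (fun a => b a = i) (fun a => b a = i) = (U.toSquareBlock b i)⁻¹ := by
    intro i
    ext ⟨a, ha⟩ ⟨c, hc⟩
    subst ha
    simp only [toBlock_apply, hY, Matrix.of_apply, dif_pos hc]
  have hYo : ∀ i, Y.toBlock (fun a => b a = i) (fun a => b a ≠ i) = 0 := by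
    intro i
    ext ⟨a, ha⟩ ⟨c, hc⟩
    have h : ¬ b c = b a := fun h => hc (h.trans ha)
    simp only [toBlock_apply, hY, Matrix.of_apply, dif_neg h, Matrix.zero_apply]
  refine ⟨Y, ext_of_toBlock b (fun i => ?_) (fun i => ?_), hYd, hYo⟩
  · rw [toBlock_mul_of_offDiag_eq_zero b hYo U i, hYd, toBlock_one_self]
    exact nonsing_inv_mul _ (hU i)
  · rw [toBlock_mul_of_offDiag_eq_zero b hYo U i, hUoff i, Matrix.mul_zero,
      toBlock_one_disjoint (disjoint_eq_ne b i)]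

/-- Diagonal blocks of the block-diagonal part `D` of `M`. [folklore] -/
private theorem blockDiag_toSquareBlock [DecidableEq ι] {M D : Matrix m m R} {b : m → ι}
    (hD : D = Matrix.of fun a c => if b a = b c then M a c else 0) (i : ι) :
    D.toSquareBlock b i = M.toSquareBlock b i := by
  ext ⟨a, ha⟩ ⟨c, hc⟩
  simp only [toSquareBlock_def, hD, Matrix.of_apply, if_pos (ha.trans hc.symm)]

/-- Off-diagonal block rows of the block-diagonal part `D` vanish. [folklore] -/
private theorem blockDiag_toBlock_offDiag [DecidableEq ι] {M D : Matrix m m R} {b : m → ι}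
    (hD : D = Matrix.of fun a c => if b a = b c then M a c else 0) (i : ι) :
    D.toBlock (fun a => b a = i) (fun a => b a ≠ i) = 0 := by
  ext ⟨a, ha⟩ ⟨c, hc⟩
  have h : ¬ b a = b c := fun h => hc (h.symm.trans ha)
  simp only [toBlock_apply, hD, Matrix.of_apply, if_neg h, Matrix.zero_apply]

/-- Diagonal blocks along the homotopy `D + c (M − D)` are those of `M`. [folklore] -/
private theorem blockDiag_add_smul_sub_toSquareBlock [DecidableEq ι] {M D : Matrix m m R}
    {b : m → ι} (hD : D = Matrix.of fun a c => if b a = b c then M a c else 0) (c : R) (i : ι) :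
    (D + c • (M - D)).toSquareBlock b i = M.toSquareBlock b i := by
  ext ⟨a, ha⟩ ⟨a', ha'⟩
  simp only [toSquareBlock_def, Matrix.of_apply, Matrix.add_apply, Matrix.smul_apply,
    Matrix.sub_apply, hD, if_pos (ha.trans ha'.symm), sub_self, smul_zero, add_zero]

/-- Off-diagonal block rows along the homotopy `D + c (M − D)` are `c` times those of `M`.
[folklore] -/
private theorem blockDiag_add_smul_sub_toBlock_offDiag [DecidableEq ι] {M D : Matrix m m R}
    {b : m → ι} (hD : D = Matrix.of fun a c => if b a = b c then M a c else 0) (c : R) (i : ι) :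
    (D + c • (M - D)).toBlock (fun a => b a = i) (fun a => b a ≠ i) =
      c • M.toBlock (fun a => b a = i) (fun a => b a ≠ i) := by
  ext ⟨a, ha⟩ ⟨a', ha'⟩
  have h : ¬ b a = b a' := fun h => ha' (h.symm.trans ha)
  simp only [toBlock_apply, Matrix.add_apply, Matrix.smul_apply, Matrix.sub_apply, hD,
    Matrix.of_apply, if_neg h, sub_zero, zero_add]

/-- Off-diagonal block rows of `z • 1 − D` vanish. [folklore] -/
private theorem smul_one_sub_blockDiag_toBlock_offDiag [DecidableEq m] [DecidableEq ι]
    {M D : Matrix m m R} {b : m → ι}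
    (hD : D = Matrix.of fun a c => if b a = b c then M a c else 0) (z : R) (i : ι) :
    (z • (1 : Matrix m m R) - D).toBlock (fun a => b a = i) (fun a => b a ≠ i) = 0 := by
  ext ⟨a, ha⟩ ⟨c, hc⟩
  have h : ¬ b a = b c := fun h => hc (h.symm.trans ha)
  have hac : a ≠ c := fun hac => h (hac ▸ rfl)
  simp only [toBlock_apply, Matrix.sub_apply, Matrix.smul_apply, Matrix.one_apply_ne hac,
    smul_zero, hD, Matrix.of_apply, if_neg h, sub_zero, Matrix.zero_apply]

/-- Diagonal blocks of `z • 1 − D` are `z • 1 − Mᵢᵢ`. [folklore] -/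
private theorem smul_one_sub_blockDiag_toSquareBlock [DecidableEq m] [DecidableEq ι]
    {M D : Matrix m m R} {b : m → ι}
    (hD : D = Matrix.of fun a c => if b a = b c then M a c else 0) (z : R) (i : ι) :
    (z • (1 : Matrix m m R) - D).toSquareBlock b i =
      z • (1 : Matrix {a // b a = i} {a // b a = i} R) - M.toSquareBlock b i := by
  ext ⟨a, ha⟩ ⟨c, hc⟩
  have hbc : b a = b c := ha.trans hc.symm
  simp [toSquareBlock_def, Matrix.sub_apply, Matrix.smul_apply, Matrix.one_apply, hD, hbc]

/-- Diagonal blocks of `M − D` vanish. [folklore] -/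
private theorem sub_blockDiag_toBlock_diag [DecidableEq ι] {M D : Matrix m m R} {b : m → ι}
    (hD : D = Matrix.of fun a c => if b a = b c then M a c else 0) (i : ι) :
    (M - D).toBlock (fun a => b a = i) (fun a => b a = i) = 0 := by
  ext ⟨a, ha⟩ ⟨c, hc⟩
  simp only [toBlock_apply, Matrix.sub_apply, hD, Matrix.of_apply, if_pos (ha.trans hc.symm),
    sub_self, Matrix.zero_apply]

/-- Off-diagonal block rows of `M − D` are those of `M`. [folklore] -/
private theorem sub_blockDiag_toBlock_offDiag [DecidableEq ι] {M D : Matrix m m R} {b : m → ι}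
    (hD : D = Matrix.of fun a c => if b a = b c then M a c else 0) (i : ι) :
    (M - D).toBlock (fun a => b a = i) (fun a => b a ≠ i) =
      M.toBlock (fun a => b a = i) (fun a => b a ≠ i) := by
  ext ⟨a, ha⟩ ⟨c, hc⟩
  have h : ¬ b a = b c := fun h => hc (h.symm.trans ha)
  simp only [toBlock_apply, Matrix.sub_apply, hD, Matrix.of_apply, if_neg h, sub_zero]

/-- `D + (M − D) = M`. [folklore] -/
private theorem blockDiag_add_sub (M D : Matrix m m R) : D + (M - D) = M := add_sub_cancel D M

end Algebra

/-! ### `ℓ∞` operator norm: per-block resolvent conditions -/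

section SupNorm

open scoped _root_.Matrix.Norms.Operator

variable {K : Type*} [NormedField K] {m : Type*} [Fintype m] {ι : Type*}

/-- A row sum of entry norms is at most the `ℓ∞` operator norm (rectangular). [folklore] -/
private theorem sum_norm_le_linfty_opNorm {l k : Type*} [Fintype l] [Fintype k]
    (N : Matrix l k K) (a : l) : ∑ c, ‖N a c‖ ≤ ‖N‖ := by
  have h : (∑ c, ‖N a c‖₊) ≤ ‖N‖₊ := by
    rw [linfty_opNNNorm_def]
    exact Finset.le_sup (f := fun a' => ∑ c, ‖N a' c‖₊) (Finset.mem_univ a)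
  have h' : ((∑ c, ‖N a c‖₊ : NNReal) : ℝ) ≤ (‖N‖₊ : ℝ) := NNReal.coe_le_coe.mpr h
  simpa only [NNReal.coe_sum, coe_nnnorm] using h'

/-- If every row sum of entry norms is `< t` (`0 < t`) then the `ℓ∞` operator norm is `< t`.
[folklore] -/
private theorem linfty_opNorm_lt_of_forall_row_sum_lt {l k : Type*} [Fintype l] [Fintype k]
    {N : Matrix l k K} {t : ℝ} (ht : 0 < t) (h : ∀ a, ∑ c, ‖N a c‖ < t) : ‖N‖ < t := by
  rcases (Finset.univ : Finset l).eq_empty_or_nonempty with hl | hl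
  · have h0 : ‖N‖ = 0 := by
      rw [linfty_opNorm_def, hl, Finset.sup_empty]
      rfl
    rw [h0]
    exact ht
  · obtain ⟨a, -, ha⟩ := Finset.exists_mem_eq_sup _ hl (fun a' => ∑ c, ‖N a' c‖₊)
    rw [linfty_opNorm_def, ha]
    push_cast
    exact h a

/-- If every row sum of entry norms is `≤ r` (`0 ≤ r`) then the `ℓ∞` operator norm is `≤ r`
(rectangular version of `BauerFike.linfty_opNorm_le_of_row_sum_le`). [folklore] -/
private theorem linfty_opNorm_le_of_forall_row_sum_le {l k : Type*} [Fintype l] [Fintype k]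
    {N : Matrix l k K} {r : ℝ} (hr : 0 ≤ r) (h : ∀ a, ∑ c, ‖N a c‖ ≤ r) : ‖N‖ ≤ r := by
  rw [linfty_opNorm_def]
  have hsup : (Finset.univ.sup fun a => ∑ c, ‖N a c‖₊) ≤ ⟨r, hr⟩ :=
    Finset.sup_le fun a _ => by
      rw [← NNReal.coe_le_coe]
      push_cast
      exact h a
  exact NNReal.coe_le_coe.mpr hsup

/-- The norm of a matrix with ZERO DIAGONAL BLOCKS is controlled by its off-diagonal block rows:
if each has norm `< t` (`0 < t`) then `‖N‖ < t` (Varga's computation in the proof of Thm 6.13: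
a row of `N` inside block `i` is a row of `N_[i, ≠ i]` padded by zeros). [folklore] -/
private theorem linfty_opNorm_lt_of_blocks [DecidableEq ι] (b : m → ι) {N : Matrix m m K}
    (hdiag : ∀ i, N.toBlock (fun a => b a = i) (fun a => b a = i) = 0) {t : ℝ} (ht : 0 < t)
    (hoff : ∀ i, ‖N.toBlock (fun a => b a = i) (fun a => b a ≠ i)‖ < t) : ‖N‖ < t := by
  refine linfty_opNorm_lt_of_forall_row_sum_lt ht fun a => ?_
  rw [← Fintype.sum_subtype_add_sum_subtype (fun c => b c = b a) (fun c => ‖N a c‖)]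
  have h1 : ∑ c : {c // b c = b a}, ‖N a c‖ = 0 := by
    refine Finset.sum_eq_zero fun c _ => ?_
    have h := congr_fun (congr_fun (hdiag (b a)) ⟨a, rfl⟩) c
    simp only [toBlock_apply, Matrix.zero_apply] at h
    rw [h, norm_zero]
  have h2 : ∑ c : {c // ¬ b c = b a}, ‖N a c‖ ≤
      ‖N.toBlock (fun c => b c = b a) (fun c => b c ≠ b a)‖ :=
    sum_norm_le_linfty_opNorm (N.toBlock (fun c => b c = b a) (fun c => b c ≠ b a)) ⟨a, rfl⟩
  rw [h1, zero_add]
  exact h2.trans_lt (hoff (b a))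

/-- **Rectangular verified inverse bound** (Golub–Van Loan Lemma 2.3.3 with a rectangular
right factor): `‖1 − Y V‖ < 1` ⇒ `V` invertible and `‖V⁻¹ R‖ ≤ ‖Y R‖ / (1 − ‖1 − Y V‖)`
(from `V⁻¹ R = Y R + (1 − Y V) V⁻¹ R`). [cite: GolubVanLoan2013, §2.3.4 Lemma 2.3.3] -/
theorem linfty_norm_inv_mul_le_of_approxInverse {p k : Type*} [Fintype p] [DecidableEq p]
    [Fintype k] {V Y : Matrix p p K} (hβ : ‖1 - Y * V‖ < 1) (R : Matrix p k K) :
    IsUnit V.det ∧ ‖V⁻¹ * R‖ ≤ ‖Y * R‖ / (1 - ‖1 - Y * V‖) := by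
  have hV : IsUnit V.det := BauerFike.linfty_isUnit_det_of_norm_one_sub_mul_lt hβ
  refine ⟨hV, ?_⟩
  have hid : V⁻¹ * R = Y * R + (1 - Y * V) * (V⁻¹ * R) := by
    rw [Matrix.sub_mul, Matrix.one_mul, Matrix.mul_assoc, mul_nonsing_inv_cancel_left V R hV]
    abel
  have h1 : ‖V⁻¹ * R‖ ≤ ‖Y * R‖ + ‖1 - Y * V‖ * ‖V⁻¹ * R‖ :=
    calc ‖V⁻¹ * R‖ = ‖Y * R + (1 - Y * V) * (V⁻¹ * R)‖ := by rw [← hid]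
      _ ≤ ‖Y * R‖ + ‖(1 - Y * V) * (V⁻¹ * R)‖ := norm_add_le _ _
      _ ≤ ‖Y * R‖ + ‖1 - Y * V‖ * ‖V⁻¹ * R‖ := by
          gcongr
          exact linfty_opNorm_mul _ _
  rw [le_div_iff₀ (sub_pos.mpr hβ)]
  nlinarith [h1, norm_nonneg (V⁻¹ * R)]

/-- **Certified ⇒ exact, per block**: `‖1 − Y V‖ + ‖Y R‖ < 1` for some `Y` ⇒ `V` invertible and
`‖V⁻¹ R‖ < 1` (rectangular `R`). [cite: GolubVanLoan2013, §2.3.4 Lemma 2.3.3] -/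
theorem linfty_norm_inv_mul_lt_one_of_approxInverse {p k : Type*} [Fintype p] [DecidableEq p]
    [Fintype k] {V Y : Matrix p p K} {R : Matrix p k K} (h : ‖1 - Y * V‖ + ‖Y * R‖ < 1) :
    IsUnit V.det ∧ ‖V⁻¹ * R‖ < 1 := by
  have hβ : ‖1 - Y * V‖ < 1 := (le_add_of_nonneg_right (norm_nonneg _)).trans_lt h
  obtain ⟨hV, hle⟩ := linfty_norm_inv_mul_le_of_approxInverse hβ R
  refine ⟨hV, hle.trans_lt ?_⟩
  rw [div_lt_one (sub_pos.mpr hβ)]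
  linarith

/-- **Varga (6.30) for one block row**: the `ℓ∞` operator norm of the off-diagonal block row
`[A_{ik}]_{k ≠ i}` is at most Feingold–Varga's radius `rᵢ = Σ_{k ≠ i} ‖A_{ik}‖` ((2.4); Varga
(6.8)): "`‖B‖_φ ≤ ‖[‖B_{j,k}‖_φ]‖_∞`", here for the matrix `B` consisting of the single block row.
[cite: Varga2004, §6.2 (6.30)] [cite: FeingoldVarga1962, §2 (2.4)] -/
theorem linfty_norm_offDiag_le [Fintype ι] [DecidableEq ι] (M : Matrix m m K) (b : m → ι)
    (i : ι) :
    ‖M.toBlock (fun a => b a = i) (fun a => b a ≠ i)‖ ≤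
      ∑ j ∈ Finset.univ.erase i, ‖M.toBlock (fun a => b a = i) (fun a => b a = j)‖ := by
  refine linfty_opNorm_le_of_forall_row_sum_le (Finset.sum_nonneg fun j _ => norm_nonneg _)
    fun a => ?_
  have hsplit : ∑ c : {c // b c ≠ i}, ‖M.toBlock (fun a => b a = i) (fun a => b a ≠ i) a c‖ =
      ∑ j ∈ Finset.univ.erase i, ∑ c : {c // b c = j}, ‖M (a : m) c‖ := by
    have h1 : ∑ c : {c // b c ≠ i}, ‖M.toBlock (fun a => b a = i) (fun a => b a ≠ i) a c‖ =
        ∑ c ∈ Finset.univ.filter (fun c => b c ≠ i), ‖M (a : m) c‖ := by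
      rw [Finset.sum_subtype (Finset.univ.filter fun c => b c ≠ i) (p := fun c => b c ≠ i)
        (fun c => by simp)]
      rfl
    have h2 : ∀ j ∈ Finset.univ.erase i, ∑ c : {c // b c = j}, ‖M (a : m) c‖ =
        ∑ c ∈ Finset.univ.filter (fun c => b c = j), ‖M (a : m) c‖ := fun j _ => by
      rw [Finset.sum_subtype (Finset.univ.filter fun c => b c = j) (p := fun c => b c = j)
        (fun c => by simp)]
    rw [h1, Finset.sum_congr rfl h2, Finset.sum_fiberwise_eq_sum_filter]
    refine Finset.sum_congr ?_ fun _ _ => rfl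
    ext c
    simp
  rw [hsplit]
  exact Finset.sum_le_sum fun j _ =>
    sum_norm_le_linfty_opNorm (M.toBlock (fun a => b a = i) (fun a => b a = j)) a

/-- **The engine** (Varga's proof of Thm 6.13): if `U` is block diagonal with invertible diagonal
blocks, `F` has zero diagonal blocks, and `‖Uᵢᵢ⁻¹ F_[i, ≠ i]‖ < 1` for every block, then the
assembled `Y = diag(Uᵢᵢ⁻¹)` has `Y U = 1` and `‖Y F‖ < 1` (the rows of `Y F` in block `i` are the
rows of `Uᵢᵢ⁻¹ F_[i, ≠ i]` padded by zeros). [folklore] -/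
private theorem exists_leftInverse_norm_mul_lt [DecidableEq m] [DecidableEq ι] (b : m → ι)
    {U F : Matrix m m K} (hUoff : ∀ i, U.toBlock (fun a => b a = i) (fun a => b a ≠ i) = 0)
    (hFdiag : ∀ i, F.toBlock (fun a => b a = i) (fun a => b a = i) = 0)
    (h : ∀ i, IsUnit (U.toSquareBlock b i).det ∧
      ‖(U.toSquareBlock b i)⁻¹ * F.toBlock (fun a => b a = i) (fun a => b a ≠ i)‖ < 1) :
    ∃ Y : Matrix m m K, Y * U = 1 ∧ ‖Y * F‖ < 1 := by
  obtain ⟨Y, hYU, hYd, hYo⟩ := exists_blockDiag_leftInverse b hUoff fun i => (h i).1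
  refine ⟨Y, hYU, linfty_opNorm_lt_of_blocks b (fun i => ?_) zero_lt_one fun i => ?_⟩
  · rw [toBlock_mul_of_offDiag_eq_zero b hYo F i, hFdiag i, Matrix.mul_zero]
  · rw [toBlock_mul_of_offDiag_eq_zero b hYo F i, hYd]
    exact (h i).2

/-- **Per-block exact resolvent conditions ⇒ the global certified resolvent condition** for the
splitting `M = D + (M − D)`, `D` the block-diagonal part: if every `z − Mᵢᵢ` is invertible with
`‖(z − Mᵢᵢ)⁻¹ [M_{ik}]_{k≠i}‖ < 1`, then some `Y` (namely `diag((z − Mᵢᵢ)⁻¹)`) satisfies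
`‖1 − Y (z − D)‖ + ‖Y (M − D)‖ < 1`. [folklore] -/
private theorem exists_approxInverse_blockDiag [DecidableEq m] [DecidableEq ι]
    {M D : Matrix m m K} {b : m → ι}
    (hD : D = Matrix.of fun a c => if b a = b c then M a c else 0) {z : K}
    (h : ∀ i, IsUnit (z • (1 : Matrix {a // b a = i} {a // b a = i} K) - M.toSquareBlock b i).det ∧
      ‖(z • (1 : Matrix {a // b a = i} {a // b a = i} K) - M.toSquareBlock b i)⁻¹ *
        M.toBlock (fun a => b a = i) (fun a => b a ≠ i)‖ < 1) :
    ∃ Y : Matrix m m K, ‖1 - Y * (z • (1 : Matrix m m K) - D)‖ + ‖Y * (M - D)‖ < 1 := by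
  obtain ⟨Y, hYU, hYF⟩ := exists_leftInverse_norm_mul_lt b
    (smul_one_sub_blockDiag_toBlock_offDiag hD z) (sub_blockDiag_toBlock_diag hD) fun i => by
      rw [smul_one_sub_blockDiag_toSquareBlock hD, sub_blockDiag_toBlock_offDiag hD]
      exact h i
  refine ⟨Y, ?_⟩
  rw [hYU, sub_self, norm_zero, zero_add]
  exact hYF

/-- **Nonsingularity from per-block conditions, Robert form** (Feingold–Varga Thm 1 with the
sharper hypothesis `‖Mᵢᵢ⁻¹ [M_{ik}]_{k≠i}‖_∞ < 1` for every block `i`, i.e. `0 ∉ 𝓡_π(M)` of Varga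
(6.35)): then `M` is nonsingular. [cite: FeingoldVarga1962, §2 Thm 1]
[cite: Varga2004, §6.2 (6.35) Thm 6.12] -/
theorem linfty_isUnit_det_of_blocks [DecidableEq m] [DecidableEq ι] (M : Matrix m m K) (b : m → ι)
    (h : ∀ i, IsUnit (M.toSquareBlock b i).det ∧
      ‖(M.toSquareBlock b i)⁻¹ * M.toBlock (fun a => b a = i) (fun a => b a ≠ i)‖ < 1) :
    IsUnit M.det := by
  obtain ⟨D, hD⟩ : ∃ D : Matrix m m K, D = Matrix.of fun a c => if b a = b c then M a c else 0 :=
    ⟨_, rfl⟩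
  obtain ⟨Y, hYU, hYF⟩ := exists_leftInverse_norm_mul_lt b (blockDiag_toBlock_offDiag hD)
    (sub_blockDiag_toBlock_diag hD) fun i => by
      rw [blockDiag_toSquareBlock hD, sub_blockDiag_toBlock_offDiag hD]
      exact h i
  refine BauerFike.linfty_isUnit_det_of_norm_one_sub_mul_lt (Y := Y) ?_
  have h1 : 1 - Y * M = -(Y * (M - D)) := by
    rw [Matrix.mul_sub, hYU]
    abel
  rw [h1, norm_neg]
  exact hYF

/-- **Nonsingularity from per-block CERTIFIED conditions** (the verifier's form of
Feingold–Varga Thm 1: approximate inverses `Yᵢ` of the diagonal blocks with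
`‖1 − Yᵢ Mᵢᵢ‖ + ‖Yᵢ [M_{ik}]_{k≠i}‖ < 1`). [cite: FeingoldVarga1962, §2 Thm 1]
[cite: GolubVanLoan2013, §2.3.4 Lemma 2.3.3] -/
theorem linfty_isUnit_det_of_blocks_certified [DecidableEq m] [DecidableEq ι] (M : Matrix m m K)
    (b : m → ι) (h : ∀ i, ∃ Y : Matrix {a // b a = i} {a // b a = i} K,
      ‖1 - Y * M.toSquareBlock b i‖ + ‖Y * M.toBlock (fun a => b a = i) (fun a => b a ≠ i)‖ < 1) :
    IsUnit M.det :=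
  linfty_isUnit_det_of_blocks M b fun i => by
    obtain ⟨Y, hY⟩ := h i
    exact linfty_norm_inv_mul_lt_one_of_approxInverse hY

/-- **Feingold–Varga Thm 1 / Varga Thm 6.2: a block strictly diagonally dominant matrix is
nonsingular**, literally, `ℓ∞` norms on every block: if `rᵢ = Σ_{k ≠ i} ‖M_{ik}‖ < (‖Mᵢᵢ⁻¹‖)⁻¹`
for every block `i` (Def 1 (2.4) strict; Varga Def 6.1 (6.9); with Lean's `A⁻¹ = 0` for singular
`A` the hypothesis already forces every `Mᵢᵢ` to be nonsingular, as Feingold–Varga require), then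
`M` is nonsingular. [cite: FeingoldVarga1962, §2 Def 1 (2.4), Thm 1]
[cite: Varga2004, §6.1 Def 6.1 (6.9), Thm 6.2] -/
theorem linfty_isUnit_det_of_blockDominant [DecidableEq m] [Fintype ι] [DecidableEq ι]
    (M : Matrix m m K) (b : m → ι)
    (h : ∀ i, ∑ j ∈ Finset.univ.erase i, ‖M.toBlock (fun a => b a = i) (fun a => b a = j)‖ <
      ‖(M.toSquareBlock b i)⁻¹‖⁻¹) :
    IsUnit M.det := by
  refine linfty_isUnit_det_of_blocks M b fun i => ?_
  have hr : 0 ≤ ∑ j ∈ Finset.univ.erase i, ‖M.toBlock (fun a => b a = i) (fun a => b a = j)‖ :=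
    Finset.sum_nonneg fun j _ => norm_nonneg _
  have hpos : 0 < ‖(M.toSquareBlock b i)⁻¹‖ := inv_pos.mp (hr.trans_lt (h i))
  have hU : IsUnit (M.toSquareBlock b i).det := by
    by_contra hU
    rw [nonsing_inv_apply_not_isUnit _ hU, norm_zero] at hpos
    exact lt_irrefl _ hpos
  refine ⟨hU, (linfty_opNorm_mul _ _).trans_lt ?_⟩
  calc ‖(M.toSquareBlock b i)⁻¹‖ * ‖M.toBlock (fun a => b a = i) (fun a => b a ≠ i)‖
      ≤ ‖(M.toSquareBlock b i)⁻¹‖ *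
          ∑ j ∈ Finset.univ.erase i, ‖M.toBlock (fun a => b a = i) (fun a => b a = j)‖ :=
        mul_le_mul_of_nonneg_left (linfty_norm_offDiag_le M b i) (norm_nonneg _)
    _ < ‖(M.toSquareBlock b i)⁻¹‖ * ‖(M.toSquareBlock b i)⁻¹‖⁻¹ :=
        mul_lt_mul_of_pos_left (h i) hpos
    _ = 1 := mul_inv_cancel₀ hpos.ne'

/-- **Exclusion of a point by per-block resolvent conditions** (Varga Thm 6.12 (6.35)–(6.37) read
contrapositively: `z ∉ 𝓡_π(A)` ⇒ `z ∉ σ(A)`): if every `z − Mᵢᵢ` is invertible and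
`‖(z − Mᵢᵢ)⁻¹ [M_{ik}]_{k≠i}‖_∞ < 1`, then `z` is not an eigenvalue of `M`.
[cite: Varga2004, §6.2 Thm 6.12 (6.37)] -/
theorem linfty_not_isRoot_charpoly_of_blocks [DecidableEq m] [DecidableEq ι] (M : Matrix m m K)
    (b : m → ι) {z : K}
    (h : ∀ i, IsUnit (z • (1 : Matrix {a // b a = i} {a // b a = i} K) - M.toSquareBlock b i).det ∧
      ‖(z • (1 : Matrix {a // b a = i} {a // b a = i} K) - M.toSquareBlock b i)⁻¹ *
        M.toBlock (fun a => b a = i) (fun a => b a ≠ i)‖ < 1) :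
    ¬ M.charpoly.IsRoot z := by
  obtain ⟨D, hD⟩ : ∃ D : Matrix m m K, D = Matrix.of fun a c => if b a = b c then M a c else 0 :=
    ⟨_, rfl⟩
  obtain ⟨Y, hY⟩ := exists_approxInverse_blockDiag hD h
  have h1 := Resolvent.linfty_not_isRoot_charpoly_add_of_approxInverse hY
  rwa [blockDiag_add_sub] at h1

/-- **Exclusion of a point by per-block CERTIFIED resolvent conditions** (the verifier's form:
approximate inverses `Yᵢ` of the small blocks `z − Mᵢᵢ`, `‖1 − Yᵢ (z − Mᵢᵢ)‖ + ‖Yᵢ [M_{ik}]_{k≠i}‖ < 1`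
for every block `i`) ⇒ `z` is not an eigenvalue of `M`. [cite: Varga2004, §6.2 Thm 6.12 (6.37)]
[cite: GolubVanLoan2013, §2.3.4 Lemma 2.3.3] -/
theorem linfty_not_isRoot_charpoly_of_blocks_certified [DecidableEq m] [DecidableEq ι]
    (M : Matrix m m K) (b : m → ι) {z : K}
    (h : ∀ i, ∃ Y : Matrix {a // b a = i} {a // b a = i} K,
      ‖1 - Y * (z • (1 : Matrix {a // b a = i} {a // b a = i} K) - M.toSquareBlock b i)‖ +
        ‖Y * M.toBlock (fun a => b a = i) (fun a => b a ≠ i)‖ < 1) :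
    ¬ M.charpoly.IsRoot z :=
  linfty_not_isRoot_charpoly_of_blocks M b fun i => by
    obtain ⟨Y, hY⟩ := h i
    exact linfty_norm_inv_mul_lt_one_of_approxInverse hY

/-- **Block Gershgorin inclusion, Robert form** (Varga Thm 6.12 (6.37): `σ(A) ⊆ 𝓡_π(A)`): for
every eigenvalue `μ` of `M` there is a block `i` with `μ − Mᵢᵢ` singular or
`1 ≤ ‖(μ − Mᵢᵢ)⁻¹ [M_{ik}]_{k≠i}‖_∞`. [cite: Varga2004, §6.2 Thm 6.12 (6.35)–(6.37)] -/
theorem linfty_exists_one_le_of_isRoot_charpoly [DecidableEq m] [DecidableEq ι]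
    (M : Matrix m m K) (b : m → ι) {μ : K}
    (hμ : M.charpoly.IsRoot μ) :
    ∃ i, IsUnit (μ • (1 : Matrix {a // b a = i} {a // b a = i} K) - M.toSquareBlock b i).det →
      1 ≤ ‖(μ • (1 : Matrix {a // b a = i} {a // b a = i} K) - M.toSquareBlock b i)⁻¹ *
        M.toBlock (fun a => b a = i) (fun a => b a ≠ i)‖ := by
  by_contra hc
  refine linfty_not_isRoot_charpoly_of_blocks M b (fun i => ?_) hμ
  by_contra hi
  exact hc ⟨i, fun hV => not_lt.mp fun hlt => hi ⟨hV, hlt⟩⟩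

/-- **Feingold–Varga's block Gershgorin theorem** (Thm 2 (2.10); Varga Thm 6.3 (6.12)–(6.13)
`σ(A) ⊆ Γ_π(A)`), `ℓ∞` norms on every block: each eigenvalue `μ` of `M` satisfies
`(‖(μ − Mᵢᵢ)⁻¹‖)⁻¹ ≤ rᵢ = Σ_{k ≠ i} ‖M_{ik}‖` for at least one block `i`. Lean's convention
`A⁻¹ = 0` for singular `A` makes the left side `0` when `μ ∈ σ(Mᵢᵢ)`, which is exactly
Feingold–Varga's continuity convention following (2.5). [cite: FeingoldVarga1962, §2 Thm 2 (2.10)]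
[cite: Varga2004, §6.1 Thm 6.3 (6.13)] -/
theorem linfty_exists_inv_norm_resolvent_le_of_isRoot_charpoly [DecidableEq m] [Fintype ι]
    [DecidableEq ι] (M : Matrix m m K) (b : m → ι) {μ : K} (hμ : M.charpoly.IsRoot μ) :
    ∃ i, ‖(μ • (1 : Matrix {a // b a = i} {a // b a = i} K) - M.toSquareBlock b i)⁻¹‖⁻¹ ≤
      ∑ j ∈ Finset.univ.erase i, ‖M.toBlock (fun a => b a = i) (fun a => b a = j)‖ := by
  obtain ⟨i, hi⟩ := linfty_exists_one_le_of_isRoot_charpoly M b hμ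
  refine ⟨i, ?_⟩
  have hr : 0 ≤ ∑ j ∈ Finset.univ.erase i, ‖M.toBlock (fun a => b a = i) (fun a => b a = j)‖ :=
    Finset.sum_nonneg fun j _ => norm_nonneg _
  set V : Matrix {a // b a = i} {a // b a = i} K :=
    μ • (1 : Matrix {a // b a = i} {a // b a = i} K) - M.toSquareBlock b i with hVdef
  by_cases hV : IsUnit V.det
  · have h1 : 1 ≤ ‖V⁻¹‖ *
        ∑ j ∈ Finset.univ.erase i, ‖M.toBlock (fun a => b a = i) (fun a => b a = j)‖ :=
      (hi hV).trans ((linfty_opNorm_mul _ _).trans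
        (mul_le_mul_of_nonneg_left (linfty_norm_offDiag_le M b i) (norm_nonneg _)))
    have hpos : 0 < ‖V⁻¹‖ := by
      refine lt_of_le_of_ne (norm_nonneg _) fun h0 => ?_
      rw [← h0, zero_mul] at h1
      exact absurd h1 (by norm_num)
    exact (inv_le_iff_one_le_mul₀' hpos).mpr h1
  · rw [nonsing_inv_apply_not_isUnit _ hV, norm_zero, _root_.inv_zero]
    exact hr

/-- **Feingold–Varga's Gershgorin set is the non-certifiable set** (Def 3 (3.1) with (2.5):
`z ∈ Gⱼ ⇔ (‖(Aⱼⱼ − z)⁻¹‖)⁻¹ ≤ rⱼ`, the left side "defined by continuity to be zero whenever `Aⱼⱼ − z`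
is singular"; Golub–Van Loan Lemma 2.3.3 converts approximate inverses into resolvent bounds): for a
square matrix `V` over a nonempty index type and `0 ≤ ρ`,
`(∀ Y, 1 ≤ ‖1 − Y V‖_∞ + ‖Y‖_∞ ρ) ↔ (‖V⁻¹‖_∞)⁻¹ ≤ ρ` (Lean's `V⁻¹ = 0` for singular `V` realises the
convention). The left side is the form in which the set is closed in a parameter and refutable by
a single certificate `Y`. [cite: FeingoldVarga1962, §3 Def 3 (3.1)]
[cite: GolubVanLoan2013, §2.3.4 Lemma 2.3.3] -/
theorem linfty_forall_one_le_iff_inv_norm_inv_le {p : Type*} [Fintype p] [DecidableEq p]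
    [Nonempty p] (V : Matrix p p K) {ρ : ℝ} (hρ : 0 ≤ ρ) :
    (∀ Y : Matrix p p K, 1 ≤ ‖1 - Y * V‖ + ‖Y‖ * ρ) ↔ ‖V⁻¹‖⁻¹ ≤ ρ := by
  -- over a nonempty index type an invertible matrix has a nonzero inverse
  have hpos_of : IsUnit V.det → 0 < ‖V⁻¹‖ := fun hU => by
    refine norm_pos_iff.mpr fun h0 => ?_
    obtain ⟨a⟩ := ‹Nonempty p›
    have h := congr_fun (congr_fun (nonsing_inv_mul V hU) a) a
    rw [h0, Matrix.zero_mul, Matrix.zero_apply, Matrix.one_apply_eq] at h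
    exact zero_ne_one h
  constructor
  · intro h
    by_contra hlt
    rw [not_le] at hlt
    have hpos : 0 < ‖V⁻¹‖ := inv_pos.mp (hρ.trans_lt hlt)
    have hU : IsUnit V.det := by
      by_contra hU
      rw [nonsing_inv_apply_not_isUnit _ hU, norm_zero] at hpos
      exact lt_irrefl _ hpos
    have h1 := h V⁻¹
    rw [nonsing_inv_mul V hU, sub_self, norm_zero, zero_add] at h1
    have h2 : ‖V⁻¹‖ * ρ < 1 :=
      calc ‖V⁻¹‖ * ρ < ‖V⁻¹‖ * ‖V⁻¹‖⁻¹ := mul_lt_mul_of_pos_left hlt hpos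
        _ = 1 := mul_inv_cancel₀ hpos.ne'
    exact absurd h2 (not_lt.mpr h1)
  · intro h Y
    by_contra hlt
    rw [not_le] at hlt
    have hYρ : 0 ≤ ‖Y‖ * ρ := mul_nonneg (norm_nonneg _) hρ
    have hβ : ‖1 - Y * V‖ < 1 := by linarith
    have hU : IsUnit V.det := BauerFike.linfty_isUnit_det_of_norm_one_sub_mul_lt hβ
    have hpos : 0 < ‖V⁻¹‖ := hpos_of hU
    have hA : ‖V⁻¹‖ * (1 - ‖1 - Y * V‖) ≤ ‖Y‖ :=
      (le_div_iff₀ (sub_pos.mpr hβ)).mp (BauerFike.linfty_norm_inv_le le_rfl hβ)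
    have hB : 1 ≤ ‖V⁻¹‖ * ρ := (inv_le_iff_one_le_mul₀' hpos).mp h
    have key : 1 - ‖1 - Y * V‖ ≤ ‖Y‖ * ρ :=
      calc 1 - ‖1 - Y * V‖ = (1 - ‖1 - Y * V‖) * 1 := (mul_one _).symm
        _ ≤ (1 - ‖1 - Y * V‖) * (‖V⁻¹‖ * ρ) :=
            mul_le_mul_of_nonneg_left hB (sub_pos.mpr hβ).le
        _ = ‖V⁻¹‖ * (1 - ‖1 - Y * V‖) * ρ := by ring
        _ ≤ ‖Y‖ * ρ := mul_le_mul_of_nonneg_right hA hρ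
    linarith

end SupNorm

/-! ### Counting: Feingold–Varga Thm 4 for complex matrices (`ℓ∞` operator norm on every block) -/

section Counting

open scoped _root_.Matrix.Norms.Operator

/-- Root counts of a product of monic polynomials add up. [folklore] -/
private theorem countP_roots_prod_eq_sum {S : Type*} [CommRing S] [IsDomain S] {κ : Type*}
    (s : Finset κ) (f : κ → S[X]) (hf : ∀ j ∈ s, (f j).Monic) (p : S → Prop) [DecidablePred p] :
    (∏ j ∈ s, f j).roots.countP p = ∑ j ∈ s, (f j).roots.countP p := by
  induction s using Finset.cons_induction with
  | empty => simp
  | cons a s ha ih =>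
    have hs : ∀ j ∈ s, (f j).Monic := fun j hj => hf j (Finset.mem_cons_of_mem hj)
    rw [Finset.prod_cons, Finset.sum_cons, Polynomial.roots_mul
      ((hf a (Finset.mem_cons_self a s)).mul (monic_prod_of_monic s f hs)).ne_zero,
      Multiset.countP_add, ih hs]

/-- An eigenvalue `μ` of `A` has `‖(μ − A)⁻¹‖ = 0` (Lean: the inverse of a singular matrix is `0`;
Feingold–Varga: "`(‖(Aⱼⱼ − z)⁻¹‖)⁻¹` defined by continuity to be zero"). [folklore] -/
private theorem norm_inv_smul_one_sub_eq_zero {p : Type*} [Fintype p] [DecidableEq p]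
    {A : Matrix p p ℂ} {μ : ℂ} (hμ : A.charpoly.IsRoot μ) :
    ‖(μ • (1 : Matrix p p ℂ) - A)⁻¹‖ = 0 := by
  have hdet : (μ • (1 : Matrix p p ℂ) - A).det = 0 := by
    have h : (μ • (1 : Matrix p p ℂ) - A).det = A.charpoly.eval μ := by
      rw [eval_charpoly, scalar_apply, smul_one_eq_diagonal]
    rw [h]
    exact hμ
  have hU : ¬ IsUnit (μ • (1 : Matrix p p ℂ) - A).det := by
    rw [hdet]
    exact not_isUnit_zero
  rw [nonsing_inv_apply_not_isUnit _ hU, norm_zero]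

/-- The non-certifiable set `{z | ∀ Y, 1 ≤ ‖1 − Y (z − A)‖ + ‖Y‖ ρ}` is closed, as an intersection
of closed superlevel sets of continuous functions of `z`. [folklore] -/
private theorem isClosed_setOf_forall_one_le {p : Type*} [Fintype p] [DecidableEq p]
    (A : Matrix p p ℂ) (ρ : ℝ) :
    IsClosed {z : ℂ | ∀ Y : Matrix p p ℂ, 1 ≤ ‖1 - Y * (z • (1 : Matrix p p ℂ) - A)‖ + ‖Y‖ * ρ} := by
  rw [Set.setOf_forall]
  refine isClosed_iInter fun Y => isClosed_le continuous_const ?_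
  exact ((continuous_const.sub (continuous_const.mul
    ((continuous_id.smul continuous_const).sub continuous_const))).norm).add continuous_const

variable {m : Type*} [Fintype m] [DecidableEq m] {ι : Type*} [Fintype ι] [LinearOrder ι]

/-- The characteristic polynomial of the block-diagonal part is the product of those of the
diagonal blocks (`Matrix.BlockTriangular.charpoly`, empty blocks contributing `1`). [folklore] -/
private theorem blockDiag_charpoly {M D : Matrix m m ℂ} {b : m → ι}
    (hD : D = Matrix.of fun a c => if b a = b c then M a c else 0) :
    D.charpoly = ∏ i, (M.toSquareBlock b i).charpoly := by
  have hBT : D.BlockTriangular b := fun a c hlt => by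
    rw [hD, Matrix.of_apply, if_neg hlt.ne']
  rw [hBT.charpoly, Finset.prod_subset (Finset.subset_univ _) fun i _ hi => ?_]
  · exact Finset.prod_congr rfl fun i _ => by rw [blockDiag_toSquareBlock hD]
  · haveI : IsEmpty {a // b a = i} :=
      ⟨fun a => hi (Finset.mem_image.mpr ⟨a.1, Finset.mem_univ _, a.2⟩)⟩
    exact charpoly_isEmpty

/-- **Feingold–Varga Thm 4 in Kato's form: a curve certified block by block splits the spectrum
additively.** Let `φ : ℂ → ℝ` be continuous and suppose that at every point `z` of the level set
`{φ = x₀}` EVERY diagonal block admits a certificate `Yᵢ` with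
`‖1 − Yᵢ (z − Mᵢᵢ)‖_∞ + ‖Yᵢ [M_{ik}]_{k≠i}‖_∞ < 1` (so `z` lies in no block Gershgorin set). Then the
number of eigenvalues of `M` in `{φ ≤ x₀}`, with algebraic multiplicity, is the SUM over the blocks
of the number of eigenvalues of `Mᵢᵢ` there — the continuity argument of Thm 4 ("the proof,
depending on a continuity argument, follows that given in [13, p. 287]") run on the homotopy
`D + t (M − D)` from the block-diagonal part, i.e. Kato IV Thm 3.18 for the splitting
`M = D + (M − D)`. [cite: FeingoldVarga1962, §3 Thm 4] [cite: Kato1966, IV-§3.6 Thm 3.18] -/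
theorem linfty_countP_roots_charpoly_eq_sum_of_blocks_certified (M : Matrix m m ℂ) (b : m → ι)
    {φ : ℂ → ℝ} (hφ : Continuous φ) (x₀ : ℝ)
    (hres : ∀ z : ℂ, φ z = x₀ → ∀ i, ∃ Y : Matrix {a // b a = i} {a // b a = i} ℂ,
      ‖1 - Y * (z • 1 - M.toSquareBlock b i)‖ +
        ‖Y * M.toBlock (fun a => b a = i) (fun a => b a ≠ i)‖ < 1) :
    M.charpoly.roots.countP (fun μ => φ μ ≤ x₀) =
      ∑ i, (M.toSquareBlock b i).charpoly.roots.countP (fun μ => φ μ ≤ x₀) := by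
  obtain ⟨D, hD⟩ : ∃ D : Matrix m m ℂ, D = Matrix.of fun a c => if b a = b c then M a c else 0 :=
    ⟨_, rfl⟩
  have h := Resolvent.linfty_countP_roots_charpoly_add_eq D (M - D) hφ x₀ fun z hz =>
    exists_approxInverse_blockDiag hD fun i => by
      obtain ⟨Y, hY⟩ := hres z hz i
      exact linfty_norm_inv_mul_lt_one_of_approxInverse hY
  rw [blockDiag_add_sub] at h
  rw [h, blockDiag_charpoly hD, countP_roots_prod_eq_sum _ _ fun i _ => charpoly_monic _]

/-- **Feingold–Varga Thm 4 in Kato's form, exact resolvents**: the same conclusion when on the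
curve every `z − Mᵢᵢ` is invertible with `‖(z − Mᵢᵢ)⁻¹ [M_{ik}]_{k≠i}‖_∞ < 1` (the curve misses
Varga's partitioned Brauer-type set (6.34)). [cite: FeingoldVarga1962, §3 Thm 4]
[cite: Varga2004, §6.2 (6.34) Thm 6.12] -/
theorem linfty_countP_roots_charpoly_eq_sum_of_blocks (M : Matrix m m ℂ) (b : m → ι)
    {φ : ℂ → ℝ} (hφ : Continuous φ) (x₀ : ℝ)
    (hres : ∀ z : ℂ, φ z = x₀ → ∀ i,
      IsUnit (z • (1 : Matrix {a // b a = i} {a // b a = i} ℂ) - M.toSquareBlock b i).det ∧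
      ‖(z • (1 : Matrix {a // b a = i} {a // b a = i} ℂ) - M.toSquareBlock b i)⁻¹ *
        M.toBlock (fun a => b a = i) (fun a => b a ≠ i)‖ < 1) :
    M.charpoly.roots.countP (fun μ => φ μ ≤ x₀) =
      ∑ i, (M.toSquareBlock b i).charpoly.roots.countP (fun μ => φ μ ≤ x₀) := by
  refine linfty_countP_roots_charpoly_eq_sum_of_blocks_certified M b hφ x₀ fun z hz i => ?_
  obtain ⟨hU, hlt⟩ := hres z hz i
  refine ⟨(z • (1 : Matrix {a // b a = i} {a // b a = i} ℂ) - M.toSquareBlock b i)⁻¹, ?_⟩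
  rw [nonsing_inv_mul _ hU, sub_self, norm_zero, zero_add]
  exact hlt

/-- **Feingold–Varga Thm 4 in Kato's form, a disc**: if the circle `‖z − c‖ = r` is certified block
by block, the closed disc `‖μ − c‖ ≤ r` contains `Σᵢ #{eigenvalues of Mᵢᵢ in the disc}` eigenvalues
of `M`. [cite: FeingoldVarga1962, §3 Thm 4] [cite: Kato1966, IV-§3.6 Thm 3.18] -/
theorem linfty_countP_roots_charpoly_norm_sub_le_eq_sum_of_blocks_certified (M : Matrix m m ℂ)
    (b : m → ι) (c : ℂ) (r : ℝ)
    (hres : ∀ z : ℂ, ‖z - c‖ = r → ∀ i, ∃ Y : Matrix {a // b a = i} {a // b a = i} ℂ,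
      ‖1 - Y * (z • 1 - M.toSquareBlock b i)‖ +
        ‖Y * M.toBlock (fun a => b a = i) (fun a => b a ≠ i)‖ < 1) :
    M.charpoly.roots.countP (fun μ => ‖μ - c‖ ≤ r) =
      ∑ i, (M.toSquareBlock b i).charpoly.roots.countP (fun μ => ‖μ - c‖ ≤ r) :=
  linfty_countP_roots_charpoly_eq_sum_of_blocks_certified M b (φ := fun z => ‖z - c‖)
    ((continuous_id.sub continuous_const).norm) r hres

/-- **Feingold–Varga Thm 4 (the block Gershgorin counting theorem), literally.** Let every block
label be used, let `rᵢ ≥ Σ_{k≠i} ‖M_{ik}‖_∞` and let `Gᵢ = {z | (‖(z − Mᵢᵢ)⁻¹‖_∞)⁻¹ ≤ rᵢ}` be the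
(enlarged) Gershgorin sets of Def 3 (3.1). "If the union `H = ⋃_{j ∈ S} Gⱼ` of `m` Gerschgorin sets is
disjoint from the remaining `N − m` Gerschgorin sets, then `H` contains precisely `Σ_{j ∈ S} nⱼ`
eigenvalues of `A`" (`nⱼ` the order of `Aⱼⱼ`), counted with algebraic multiplicity. Proof: along
`B(t) = D + t (M − D)`, `t ∈ [0, 1]`, the diagonal blocks are fixed and the off-diagonal ones shrink,
so by Thm 2 every eigenvalue of `B(t)` stays in `⋃ Gⱼ`; the two unions are closed
(`linfty_forall_one_le_iff_inv_norm_inv_le`) and disjoint, the count is constant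
(`Gershgorin.countP_roots_charpoly_eq_of_isPreconnected`), and at `t = 0` it is `Σ_{j ∈ S} nⱼ`
because `Gⱼ ∋` every eigenvalue of `Mⱼⱼ`. [cite: FeingoldVarga1962, §3 Thm 4]
[cite: Varga2004, §6.1 Thm 6.3] -/
theorem linfty_countP_roots_charpoly_blockGershgorin_eq_sum_card (M : Matrix m m ℂ) {b : m → ι}
    (hb : Function.Surjective b) {r : ι → ℝ}
    (hr : ∀ i, ∑ j ∈ Finset.univ.erase i, ‖M.toBlock (fun a => b a = i) (fun a => b a = j)‖ ≤ r i)
    (S : Finset ι)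
    (hsep : ∀ i ∈ S, ∀ j ∉ S, ∀ z : ℂ,
      ‖(z • (1 : Matrix {a // b a = i} {a // b a = i} ℂ) - M.toSquareBlock b i)⁻¹‖⁻¹ ≤ r i →
      ‖(z • (1 : Matrix {a // b a = j} {a // b a = j} ℂ) - M.toSquareBlock b j)⁻¹‖⁻¹ ≤ r j →
        False) :
    M.charpoly.roots.countP (fun μ => ∃ i ∈ S,
        ‖(μ • (1 : Matrix {a // b a = i} {a // b a = i} ℂ) - M.toSquareBlock b i)⁻¹‖⁻¹ ≤ r i) =
      ∑ i ∈ S, Fintype.card {a // b a = i} := by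
  have hr0 : ∀ i, 0 ≤ r i := fun i => (Finset.sum_nonneg fun j _ => norm_nonneg _).trans (hr i)
  have hne : ∀ i, Nonempty {a // b a = i} := fun i => by
    obtain ⟨a, ha⟩ := hb i
    exact ⟨⟨a, ha⟩⟩
  -- the literal Gershgorin set `G i` and its closed `∀ Y` form agree pointwise
  have hG : ∀ i (z : ℂ),
      (∀ Y : Matrix {a // b a = i} {a // b a = i} ℂ,
        1 ≤ ‖1 - Y * (z • (1 : Matrix {a // b a = i} {a // b a = i} ℂ) - M.toSquareBlock b i)‖ +
          ‖Y‖ * r i) ↔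
      ‖(z • (1 : Matrix {a // b a = i} {a // b a = i} ℂ) - M.toSquareBlock b i)⁻¹‖⁻¹ ≤ r i :=
    fun i z => by
      haveI := hne i
      exact linfty_forall_one_le_iff_inv_norm_inv_le _ (hr0 i)
  -- closedness of a finite union of Gershgorin sets
  have hclosed : ∀ T : Finset ι, IsClosed {z : ℂ | ∃ i ∈ T,
      ‖(z • (1 : Matrix {a // b a = i} {a // b a = i} ℂ) - M.toSquareBlock b i)⁻¹‖⁻¹ ≤ r i} := by
    intro T
    have h : {z : ℂ | ∃ i ∈ T,
        ‖(z • (1 : Matrix {a // b a = i} {a // b a = i} ℂ) - M.toSquareBlock b i)⁻¹‖⁻¹ ≤ r i} =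
        ⋃ i ∈ T, {z : ℂ | ∀ Y : Matrix {a // b a = i} {a // b a = i} ℂ,
          1 ≤ ‖1 - Y * (z • (1 : Matrix {a // b a = i} {a // b a = i} ℂ) - M.toSquareBlock b i)‖ +
            ‖Y‖ * r i} := by
      ext z
      simp only [Set.mem_setOf_eq, Set.mem_iUnion, exists_prop, hG]
    rw [h]
    exact isClosed_biUnion_finset fun i _ => isClosed_setOf_forall_one_le _ _
  -- every eigenvalue of a matrix with the same diagonal blocks and smaller off-diagonal block
  -- rows lies in some `G i` (Thm 2)
  have hincl : ∀ (B : Matrix m m ℂ), (∀ i, B.toSquareBlock b i = M.toSquareBlock b i) →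
      (∀ i, ‖B.toBlock (fun a => b a = i) (fun a => b a ≠ i)‖ ≤ r i) →
      ∀ μ ∈ B.charpoly.roots, ∃ i,
        ‖(μ • (1 : Matrix {a // b a = i} {a // b a = i} ℂ) - M.toSquareBlock b i)⁻¹‖⁻¹ ≤ r i := by
    intro B hBd hBo μ hμ
    have hμ' : B.charpoly.IsRoot μ := (mem_roots (charpoly_monic _).ne_zero).mp hμ
    by_contra hc
    refine linfty_not_isRoot_charpoly_of_blocks_certified B b (fun i => ?_) hμ'
    have hi : ¬ ∀ Y : Matrix {a // b a = i} {a // b a = i} ℂ,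
        1 ≤ ‖1 - Y * (μ • (1 : Matrix {a // b a = i} {a // b a = i} ℂ) - M.toSquareBlock b i)‖ +
          ‖Y‖ * r i := fun h => hc ⟨i, (hG i μ).mp h⟩
    obtain ⟨Y, hY⟩ := not_forall.mp hi
    have hY' : ‖1 - Y * (μ • (1 : Matrix {a // b a = i} {a // b a = i} ℂ) - M.toSquareBlock b i)‖ +
        ‖Y‖ * r i < 1 := not_le.mp hY
    have hle : ‖Y * B.toBlock (fun a => b a = i) (fun a => b a ≠ i)‖ ≤ ‖Y‖ * r i :=
      (linfty_opNorm_mul _ _).trans (mul_le_mul_of_nonneg_left (hBo i) (norm_nonneg _))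
    refine ⟨Y, ?_⟩
    rw [hBd i]
    linarith
  -- the homotopy
  obtain ⟨D, hD⟩ : ∃ D : Matrix m m ℂ, D = Matrix.of fun a c => if b a = b c then M a c else 0 :=
    ⟨_, rfl⟩
  obtain ⟨B, hB⟩ : ∃ B : ℝ → Matrix m m ℂ, B = fun t : ℝ => D + (t : ℂ) • (M - D) := ⟨_, rfl⟩
  have hBcont : Continuous B := by
    rw [hB]
    exact continuous_const.add (Complex.continuous_ofReal.smul continuous_const)
  have hcover : ∀ t ∈ Set.Icc (0 : ℝ) 1, ∀ μ ∈ (B t).charpoly.roots,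
      (∃ i ∈ S, ‖(μ • (1 : Matrix {a // b a = i} {a // b a = i} ℂ) -
        M.toSquareBlock b i)⁻¹‖⁻¹ ≤ r i) ∨
      (∃ j ∈ Sᶜ, ‖(μ • (1 : Matrix {a // b a = j} {a // b a = j} ℂ) -
        M.toSquareBlock b j)⁻¹‖⁻¹ ≤ r j) := by
    intro t ht μ hμ
    have ht' : ‖(t : ℂ)‖ ≤ 1 := by
      rw [Complex.norm_real, Real.norm_eq_abs, abs_of_nonneg ht.1]
      exact ht.2
    obtain ⟨i, hi⟩ := hincl (B t) (fun i => by rw [hB]; exact blockDiag_add_smul_sub_toSquareBlock hD _ i)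
      (fun i => by
        rw [hB]
        dsimp only
        rw [blockDiag_add_smul_sub_toBlock_offDiag hD, norm_smul]
        exact (mul_le_of_le_one_left (norm_nonneg _) ht').trans
          ((linfty_norm_offDiag_le M b i).trans (hr i))) μ hμ
    by_cases hiS : i ∈ S
    · exact Or.inl ⟨i, hiS, hi⟩
    · exact Or.inr ⟨i, Finset.mem_compl.mpr hiS, hi⟩
  have hpq : ∀ z : ℂ,
      (∃ i ∈ S, ‖(z • (1 : Matrix {a // b a = i} {a // b a = i} ℂ) -
        M.toSquareBlock b i)⁻¹‖⁻¹ ≤ r i) →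
      (∃ j ∈ Sᶜ, ‖(z • (1 : Matrix {a // b a = j} {a // b a = j} ℂ) -
        M.toSquareBlock b j)⁻¹‖⁻¹ ≤ r j) → False := by
    rintro z ⟨i, hi, hzi⟩ ⟨j, hj, hzj⟩
    exact hsep i hi j (Finset.mem_compl.mp hj) z hzi hzj
  have hconst := Gershgorin.countP_roots_charpoly_eq_of_isPreconnected hBcont isPreconnected_Icc
    (hclosed S) (hclosed Sᶜ) hpq hcover (Set.right_mem_Icc.mpr zero_le_one)
    (Set.left_mem_Icc.mpr zero_le_one)
  have hB1 : B 1 = M := by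
    rw [hB]
    simp
  have hB0 : B 0 = D := by
    rw [hB]
    simp
  rw [hB1, hB0, blockDiag_charpoly hD, countP_roots_prod_eq_sum _ _ fun i _ => charpoly_monic _]
    at hconst
  rw [hconst, ← Finset.sum_subset (Finset.subset_univ S) fun j _ hjS => ?_]
  · refine Finset.sum_congr rfl fun j hjS => ?_
    have hall : ∀ μ ∈ (M.toSquareBlock b j).charpoly.roots, ∃ i ∈ S,
        ‖(μ • (1 : Matrix {a // b a = i} {a // b a = i} ℂ) - M.toSquareBlock b i)⁻¹‖⁻¹ ≤ r i :=
      fun μ hμ => ⟨j, hjS, by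
        rw [norm_inv_smul_one_sub_eq_zero ((mem_roots (charpoly_monic _).ne_zero).mp hμ),
          _root_.inv_zero]
        exact hr0 j⟩
    rw [Multiset.countP_eq_card.mpr hall, ← Matrix.charpoly_natDegree_eq_dim (M.toSquareBlock b j),
      (IsAlgClosed.splits (M.toSquareBlock b j).charpoly).natDegree_eq_card_roots]
  · refine Multiset.countP_eq_zero.mpr fun μ hμ ⟨i, hiS, hμi⟩ => hsep i hiS j hjS μ hμi ?_
    rw [norm_inv_smul_one_sub_eq_zero ((mem_roots (charpoly_monic _).ne_zero).mp hμ),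
      _root_.inv_zero]
    exact hr0 j

end Counting

end Literature.LinearAlgebra.Matrix.BlockGershgorin
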